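/-
Copyright (c) 2026 the pub-hodgecm-mathlib formalisation cell (harness21).  Prover seat hodgecm-mathlib-LH4-p19 (g3), req620 Track A «(D-RAM) FOUR-FRAME» squad
(STAGE-1b, row (2) of the piece `f_{T₊}`, the (β₂) road (R-36) «PURE-CELL LEDGER»; β₂ WORD #29∕#31 «p19: RAY BANDS» — the socket letters of an upper-line RAY cell at the
level of ONE cell member `(Λ, x₀)`), 2026-09-05.
-/
import Summits.HodgeConjecture.HodgeConjecture.Theorems.F0P3cDyRamUpperRayCellReads             -- ★ p864444 (this seat, R1b-A): the `hjiso` original; §2–§3 there are already `hjv`-only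
import Summits.HodgeConjecture.HodgeConjecture.Theorems.F0P3cDyRamBoundaryCellLetterCardTwo      -- ★ (LH4-p12): `v_map_eq_one_iff` (transport of `|·| = 1` along `jE` from `hjv` alone)
import HarnessLib

/-!
# Crux `H413`, line LH4 «(D-RAM) FOUR-FRAME» — STAGE-1b, row (2), the (β₂) road (R-36), (OFF) residue, RAY bands: «THE VERTEX FRAME OF A MEMBER — `hjv`-ONLY RE-ISSUE» — ★ p864444
# `…UpperRayCellReads.exists_vertexFrame_of_gen` with the isometry letter `hjiso : |jE a| = |a|` replaced by the integrality letter `hjv : |jE c| ≤ 1 ↔ |c| ≤ 1`; conclusion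
# BYTE-IDENTICAL (lane C's `jE : E → M` is not an isometry in `ℤᵐ⁰`-units, but the proof only transports `|·| ≤ 1` and `|·| = 1`)

Cell `hodgecm-mathlib` (D-0151), FLOOR 0, crux item H413 = `stmt-HodgeConjecture-24833`, route of record `HCCMUnconditional`; squad F0∕P3c∕LH4 (lane-C RAY port, LH7-p10 (g3)'s
LANEC-RAY-PROGRAM v1 5eec38bd, row G2); lane `--supports stmt-HodgeConjecture-24833 --as helper` (count-neutral; pays NO tier-0 row).  THEOREMS ONLY (no `def`, no instance, no notation,
no `sorry`, default heartbeats); ★-only imports; states NO law; (β₂) stays a HYPOTHESIS.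

WHY.  LH7-p10's census (LANEC-RAY-PROGRAM §0): every `hjiso` of the lane-B RAY chain transports only `|jE x| ≤ |jEϖ|ⁿ ↔ |x| ≤ |ϖ|ⁿ` ∕ `|jE x| = 1 ↔ |x| = 1`-type facts, which follow
from `hjv` (★ `v_map_eq_one_iff`, ★ `v_map_le_pow_iff`).  In ★ p864444 §1 `hjiso` is used twice: `|jEϖ| ≤ 1` (now `(hjv ϖ).2`) and the last line `|⟨w₀,w₀⟩·(ϖσϖ)^b| = 1` (now: compute
`|jE(⟨w₀,w₀⟩·(ϖσϖ)^b)| = 1` from `|jE⟨w₀,w₀⟩| = |jEϖ|^{−2b}` and `|jE σϖ| = |Θ(jEϖ)| = |jEϖ|` (`hΘj`, `hvΘ`), then ★ `v_map_eq_one_iff`).  §2–§3 of ★ p864444 (`dep_iff_ball`,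
`weight_ne_zero_iff_cls_of_gen6`, `weight_ne_zero_iff_normSign_of_gen6`) are already `hjv`-only and are NOT re-issued (import ★).
* HEAD `exists_vertexFrame_of_gen` — ★ p864444 §1's statement with the binder `hjiso` replaced by `hjv` (same position), everything else VERBATIM.
HONEST LABEL.  Count-neutral re-issue; nothing printed is asserted; no census law is stated; the lane-C letters stay OPEN; `HC_CM` is proved only modulo the 7 printed citations
(2 remaining named inputs: hLiu418 = `stmt-HodgeConjecture-24832`, h413 = `stmt-HodgeConjecture-24833`) until rung 0 closes.
## References
* [Kottwitz1986BaseChangeUnits] R. E. Kottwitz, *Base change for unit elements of Hecke algebras*, Compositio Math. 60 (1986): §3 (the digit fibration of a cone cell).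
* [Jacobowitz1962] R. Jacobowitz, *Hermitian forms over local fields*, Amer. J. Math. 84 (1962): §4.
* [Rogawski1990] J. D. Rogawski, *Automorphic Representations of Unitary Groups in Three Variables*, Ann. of Math. Stud. 123 (1990): §4.9 Prop. 4.9.1 (b) p. 55.
-/

set_option autoImplicit false

noncomputable section

namespace Summit.HodgeConjecture.HodgeConjecture.Cruxes.H413.F0P3cDyRamUpperRayCellReadsGen

open scoped Valued WithZero Matrix MatrixGroups
open WithZero
open Literature.NumberTheory.Automorphic Literature.NumberTheory.Automorphic.HermitianLattice Literature.NumberTheory.Automorphic.UnitaryLatticeTree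
open Literature.NumberTheory.Automorphic.UnitaryThreeFourFrame (IsRamifiedQuadraticDatum normSign)
open Literature.NumberTheory.Rogawski1990
open Summit.HodgeConjecture.HodgeConjecture.Cruxes.H413.F0P3cDyRamFourFramePieces
open Summit.HodgeConjecture.HodgeConjecture.Cruxes.H413.F0P3cDyRamFourFrameCensusDefs (LatticeInLevel)
open Summit.HodgeConjecture.HodgeConjecture.Cruxes.H413.F0P3cDyRamToricCensusDefs
open Summit.HodgeConjecture.HodgeConjecture.Cruxes.H413.F0P3cDyRamDiagonalCellLetter (inv_add_map_inv_eq_map_pairing)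
open Summit.HodgeConjecture.HodgeConjecture.Cruxes.H413.F0P3cDyRamRowCellSocketReads (exists_coord_of_gen)
open Summit.HodgeConjecture.HodgeConjecture.Cruxes.H413.F0P3cDyRamRowCellFibreTransport (trace_letters)
open Summit.HodgeConjecture.HodgeConjecture.Cruxes.H413.F0P3cDyRamUpperRayVertexReads (isOrd_div_iff_ball exactLevel_iff_sphere valueSet_eq_xPlus_iff_sphereSign)

open Summit.HodgeConjecture.HodgeConjecture.Cruxes.H413.F0P3cDyRamBoundaryCellLetterCardTwo (v_map_eq_one_iff)

variable {E M : Type} [Field E] [Valued E ℤᵐ⁰] [Field M] [Valued M ℤᵐ⁰] {ρ Θ : M →+* M} {α : M}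

/-! ## HEAD The vertex frame of a cell member: glue scalar and coordinate -/

/-- **«`hjv`-ONLY RE-ISSUE» of ★ p864444 `exists_vertexFrame_of_gen`** (binder `hjiso` ↦ `hjv`; conclusion byte-identical).  Original docstring (with `|jE a| = |a|` weakened to `|jE c| ≤ 1 ↔ |c| ≤ 1`): **THE VERTEX FRAME OF A CELL MEMBER.**  E-datum; `jE`-letters (`|jE c| ≤ 1 ↔ |c| ≤ 1`, `Fix ρ = jE(E)`, `Θ∘jE = jE∘σ`); `ρ, Θ` commuting involutive isometries; `Θh = h ≠ 0`; the form letter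
`hform` for `(H₂, φ)` with `H₂` hermitian and `φ` onto; the cell `(j, b)`, `1 ≤ b`, `cc(α − ρα) ≠ 0`, `hFgap`; a reference pair `κ₀, ξ₀ ∈ Fix Θ` (`Tr_ρ κ₀ = 1`, `ρξ₀ = −ξ₀ ≠ 0`,
`|κ₀| ≤ |ξ₀|`, `|ϖE|^b ≤ |ξ₀|·|cc(α − ρα)|`) and a member `(Λ, x₀)` with the five `GEN` clauses.  THEN there are `w₀` and a fixed integral `V ∈ E` with: `φ w₀ = Y⁻¹x₀`,
`jE V = (ρu₀∕t − κ₀)∕ξ₀` (★ p863914's `Vf x₀`; `u₀ = h·x₀Θx₀`, `t = Tr_ρ u₀`), `D₀⁻¹·(jE⟨w₀, w₀⟩)⁻¹ = κ₀ + jE V·ξ₀` (★ p862871's shape), `σ⟨w₀, w₀⟩ = ⟨w₀, w₀⟩` and `|⟨w₀, w₀⟩·(ϖσϖ)^b| = 1`.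
[cite: Jacobowitz1962, §4] [cite: Kottwitz1986BaseChangeUnits, §1 pp. 240–241] [cite: Serre1979, Ch. III §6 Prop. 12] -/
theorem exists_vertexFrame_of_gen {σ : E →+* E} {ϖ : E} {d tE : ℕ} (hD : IsRamifiedQuadraticDatum σ ϖ d tE)
    (jE : E →+* M) (hjv : ∀ c, Valued.v (jE c) ≤ 1 ↔ Valued.v c ≤ 1) (hjfix : ∀ z, ρ z = z ↔ ∃ c, jE c = z) (hΘj : ∀ c, Θ (jE c) = jE (σ c))
    (hρρ : ∀ x, ρ (ρ x) = x) (hvρ : ∀ x, Valued.v (ρ x) = Valued.v x) (hΘΘ : ∀ x, Θ (Θ x) = x) (hΘρ : ∀ x, Θ (ρ x) = ρ (Θ x)) (hvΘ : ∀ x, Valued.v (Θ x) = Valued.v x)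
    {hM : M} (hΘh : Θ hM = hM) (hh : hM ≠ 0)
    {H₂ : Matrix (Fin 2) (Fin 2) E} (hH₂σ : (H₂.map σ)ᵀ = H₂) (φ : (Fin 2 → E) →+ M) (hφo : Function.Surjective φ)
    (hform : ∀ x y, jE (pairing σ H₂ x y) = hM * Θ (φ x) * φ y + ρ (hM * Θ (φ x) * φ y))
    {j b : ℕ} (hb1 : 1 ≤ b) (hcc : jE ϖ ^ j * (α - ρ α) ≠ 0)
    (hFgap : ∀ z : M, ρ z = z → Θ z = z → Valued.v (jE ϖ) < Valued.v z → Valued.v z ≤ 1 → Valued.v z = 1)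
    {κ₀ ξ₀ : M} (hκ₀ : κ₀ + ρ κ₀ = 1) (hΘκ₀ : Θ κ₀ = κ₀) (hξ : ρ ξ₀ = -ξ₀) (hΘξ : Θ ξ₀ = ξ₀) (hξ0 : ξ₀ ≠ 0)
    (hκ₀v : Valued.v κ₀ ≤ Valued.v ξ₀) (hR : Valued.v (jE ϖ) ^ b ≤ Valued.v ξ₀ * Valued.v (jE ϖ ^ j * (α - ρ α)))
    (Λ : AddSubgroup M) (x₀ : M)
    (hG : x₀ ≠ 0 ∧ (∀ x, x ∈ Λ ↔ ∃ ζ, IsOrd ρ α (jE ϖ ^ j) ζ ∧ x = x₀ * ζ) ∧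
      IsOrd ρ α (jE ϖ ^ j) (dualGen ρ Θ α (jE ϖ ^ j) hM x₀) ∧ ¬ IsOrd ρ α (jE ϖ ^ j) (dualGen ρ Θ α (jE ϖ ^ j) hM x₀ / jE ϖ) ∧
      Valued.v (dualGen ρ Θ α (jE ϖ ^ j) hM x₀) = Valued.v (jE ϖ) ^ b) :
    ∃ (w₀ : Fin 2 → E) (V : E), φ w₀ = (dualGen ρ Θ α (jE ϖ ^ j) hM x₀)⁻¹ * x₀ ∧ σ V = V ∧ Valued.v V ≤ 1 ∧
      jE V = (ρ (hM * (x₀ * Θ x₀)) / (hM * (x₀ * Θ x₀) + ρ (hM * (x₀ * Θ x₀))) - κ₀) / ξ₀ ∧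
      (jE ϖ ^ j * (α - ρ α) * Θ (dualGen ρ Θ α (jE ϖ ^ j) hM x₀))⁻¹ * (jE (pairing σ H₂ w₀ w₀))⁻¹ = κ₀ + jE V * ξ₀ ∧
      σ (pairing σ H₂ w₀ w₀) = pairing σ H₂ w₀ w₀ ∧ Valued.v (pairing σ H₂ w₀ w₀ * (ϖ * σ ϖ) ^ b) = 1 := by
  obtain ⟨hσσ, hvσ, hϖ, -, -, -, -⟩ := id hD
  have hvϖ0 : Valued.v ϖ ≠ 0 := by rw [hϖ]; exact exp_ne_zero
  have hϖ0 : ϖ ≠ 0 := fun h0 => hvϖ0 (by rw [h0, map_zero])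
  have hϖ1 : Valued.v ϖ ≤ 1 := by rw [hϖ, ← exp_zero, exp_le_exp]; norm_num
  have hjϖ0 : jE ϖ ≠ 0 := (map_ne_zero jE).2 hϖ0
  have hjϖ1 : Valued.v (jE ϖ) ≤ 1 := (hjv ϖ).2 hϖ1
  have hvjϖ0 : Valued.v (jE ϖ) ≠ 0 := (Valuation.ne_zero_iff _).2 hjϖ0
  have hρj : ∀ c : E, ρ (jE c) = jE c := fun c => (hjfix _).2 ⟨c, rfl⟩
  have hρϖ : ρ (jE ϖ) = jE ϖ := hρj ϖ
  have hc : ρ (jE ϖ ^ j) = jE ϖ ^ j := by rw [map_pow, hρϖ]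
  obtain ⟨hx₀, hΛx, hyO, hyprim, hylev⟩ := hG
  set Y : M := dualGen ρ Θ α (jE ϖ ^ j) hM x₀ with hYdef
  set u₀ : M := hM * (x₀ * Θ x₀) with hu₀def
  set t : M := u₀ + ρ u₀ with htdef
  -- the dual vertex generator `w₀` and the glue letter
  obtain ⟨w₀, hw₀Y⟩ := hφo (Y⁻¹ * x₀)
  set D₀ : M := jE ϖ ^ j * (α - ρ α) * Θ Y with hD₀def
  have hTr : D₀⁻¹ + ρ D₀⁻¹ = jE (pairing σ H₂ w₀ w₀) := inv_add_map_inv_eq_map_pairing σ H₂ jE hΘΘ φ hh hform hcc hx₀ hw₀Y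
  -- the coordinate (★ p863914)
  obtain ⟨V, hjV, hσV, hV1⟩ := exists_coord_of_gen (α := α) hD jE hjv hjfix hΘj hρρ hvρ hΘΘ hΘρ hΘh hb1 hcc hFgap hκ₀ hΘκ₀ hξ hΘξ hξ0 hκ₀v hR Λ x₀
    ⟨hx₀, hΛx, hyO, hyprim, hylev⟩
  -- `t` is a doubly-fixed unit; `u₀ ≠ 0`
  obtain ⟨hρt, -, ht1⟩ := trace_letters (α := α) hρρ hΘΘ hΘρ hΘh hρϖ hjϖ0 hjϖ1 hb1 hcc hFgap hyO hyprim hylev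
  have ht1' : Valued.v t = 1 := by rw [htdef, hu₀def]; exact ht1
  have ht0 : t ≠ 0 := fun h0 => by rw [h0, map_zero] at ht1'; exact zero_ne_one ht1'
  have hu₀0 : u₀ ≠ 0 := mul_ne_zero hh (mul_ne_zero hx₀ ((map_ne_zero Θ).2 hx₀))
  have hρu₀0 : ρ u₀ ≠ 0 := (map_ne_zero ρ).2 hu₀0
  -- `D₀ = u₀·ν` with `ν` `ρ`-fixed, so `D₀⁻¹∕(D₀⁻¹ + ρD₀⁻¹) = ρu₀∕t`
  set ν : M := jE ϖ ^ j * (α - ρ α) * (Θ (jE ϖ ^ j) * Θ (α - ρ α)) with hνdef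
  have hν0 : ν ≠ 0 := mul_ne_zero hcc (by rw [← map_mul]; exact (map_ne_zero Θ).2 hcc)
  have hD₀ν : D₀ = u₀ * ν := by
    rw [hD₀def, hYdef, dualGen_def, hu₀def, hνdef]; simp only [map_mul, hΘΘ, hΘh]; ring
  have hρν : ρ ν = ν := by
    rw [hνdef]; simp only [map_mul, map_sub, hρρ, hc, ← hΘρ]; ring
  have hκform : D₀⁻¹ * (jE (pairing σ H₂ w₀ w₀))⁻¹ = ρ u₀ / t := by
    rw [← hTr, hD₀ν, map_inv₀, map_mul, hρν, htdef]
    field_simp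
    ring
  have hκ : D₀⁻¹ * (jE (pairing σ H₂ w₀ w₀))⁻¹ = κ₀ + jE V * ξ₀ := by
    rw [hκform, hjV, div_mul_cancel₀ _ hξ0]; ring
  -- `σ pw = pw` (hermitian symmetry) and `|pw·P| = 1`
  have hH₂h : ∀ a c : Fin 2, σ (H₂ a c) = H₂ c a := fun a c => by
    have e := congrFun (congrFun hH₂σ c) a
    rwa [Matrix.transpose_apply, Matrix.map_apply] at e
  have hσpw : σ (pairing σ H₂ w₀ w₀) = pairing σ H₂ w₀ w₀ := (pairing_comm_of_hermitian hσσ hH₂h w₀ w₀).symm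
  have hpw0 : jE (pairing σ H₂ w₀ w₀) ≠ 0 := fun h0 => by
    have := hκform
    rw [h0, inv_zero, mul_zero] at this
    exact div_ne_zero hρu₀0 ht0 this.symm
  have hpwv : Valued.v (jE (pairing σ H₂ w₀ w₀)) = (Valued.v (jE ϖ) ^ (2 * b))⁻¹ := by
    -- `|D₀| = |cc(α − ρα)|·|Y|`, `|ρu₀∕t| = |u₀| = |Y|∕|cc(α − ρα)|`
    have hvD : Valued.v D₀ = Valued.v (jE ϖ ^ j * (α - ρ α)) * Valued.v (jE ϖ) ^ b := by
      rw [hD₀def, Valuation.map_mul, hvΘ, hylev]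
    have hYu : Y = u₀ * (jE ϖ ^ j * (α - ρ α)) := by rw [hYdef, dualGen_def]
    have hvκ : Valued.v (ρ u₀ / t) * Valued.v (jE ϖ ^ j * (α - ρ α)) = Valued.v (jE ϖ) ^ b := by
      rw [map_div₀, hvρ, ht1', div_one, ← Valuation.map_mul, ← hYu, hylev]
    have hD₀0 : D₀ ≠ 0 := by rw [hD₀ν]; exact mul_ne_zero hu₀0 hν0
    have e : D₀ * (ρ u₀ / t) * jE (pairing σ H₂ w₀ w₀) = 1 := by
      rw [← hκform]; field_simp
    have hprod : Valued.v D₀ * Valued.v (ρ u₀ / t) = Valued.v (jE ϖ) ^ (2 * b) := by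
      rw [hvD, mul_right_comm, mul_comm (Valued.v (jE ϖ ^ j * (α - ρ α))), hvκ, ← pow_add, ← two_mul]
    have hv := congrArg Valued.v e
    rw [Valuation.map_mul, Valuation.map_mul, Valuation.map_one, hprod] at hv
    exact eq_inv_of_mul_eq_one_right hv
  refine ⟨w₀, V, hw₀Y, hσV, hV1, hjV, hκ, hσpw, ?_⟩
  have hjP : Valued.v (jE ((ϖ * σ ϖ) ^ b)) = Valued.v (jE ϖ) ^ (2 * b) := by
    rw [map_pow, map_mul, Valuation.map_pow, Valuation.map_mul, ← hΘj, hvΘ, ← pow_two, ← pow_mul]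
  have hj1 : Valued.v (jE (pairing σ H₂ w₀ w₀ * (ϖ * σ ϖ) ^ b)) = 1 := by
    rw [map_mul, Valuation.map_mul, hpwv, hjP, inv_mul_cancel₀ (pow_ne_zero _ hvjϖ0)]
  exact (v_map_eq_one_iff jE hjv _).1 hj1

end Summit.HodgeConjecture.HodgeConjecture.Cruxes.H413.F0P3cDyRamUpperRayCellReadsGen

end
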